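import Mathlib
import HarnessLib

/-!
# `HeteroclinicTriggerChain` — crux `TriggerChainFrontStep` (item stmt-NavierStokesRegularity-22785):
  the PREMATURE-IGNITION BUDGET of a delay window (segment form)

During the delay phase of a hop of the trigger chain the upper trigger obeys `v′ = R·v + (seed) + (junk)`
with the receiver-driven rate `R = e′y + f_R`; the sibling seat's segment-form lemmas
(`heteroclinicTriggerChain_forcedSeedOn`, `…LatticeSeed`, `…LatticeDelay`) take the primitive `Λ = ∫R` —
the PREMATURE-IGNITION BUDGET — as caller input. This file SUPPLIES it. The naive bound `Λ(T) ≤ e′·(sup y)·T`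
with `sup y ≍ y(0) + gh²/e` is `≍ e′gh²·log(1/β)/e²` for the chain (`T ≍ log(h/u₀)/e`, `u₀ ≍ β`), i.e. an
amplification `β^{−O(h²)}` (constants audit of this seat, bus 2026-08-28). The point: the receiver content
generated during the delay tracks `u²` POINTWISE, and `∫u² = O(h²/ρ₀)` over the whole window however long,
so only the INITIAL residue `y(0)` is amplified over the delay:
* `htcIB_le_of_derivWithin_nonpos` — segment monotonicity helper (one-sided derivatives on `[0, T]`);
* `htcIB_receiver_pointwise` — receiver row `y′ = gu² − w + f` (`w ≥ 0` the drain, `|f| ≤ φ`), trigger row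
  `u′ = ρu + f₂` (`ρ ≥ ρ₀ > 0`, `|f₂| ≤ φ₂`, `0 ≤ u ≤ h`): `y(t) ≤ y(0) + (g/2ρ₀)(u(t)² − u(0)²) + (φ + gφ₂h/ρ₀)t`;
* `htcIB_ignition_budget` — for `R ≤ e′y + φ_R` with primitive `Λ`, `Λ(0) = 0`:
  `Λ(t) ≤ e′y(0)t + e′(φ + gφ₂h/ρ₀)t²/2 + (e′g/4ρ₀²)(h² + 2φ₂ht) + φ_R t` on `[0, T]`.
All hypotheses are `HasDerivWithinAt` on `Icc 0 T` (the regularity of `TaoCascade.PseudoFlowOn`).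

HONEST FRAMING: elementary real analysis of scalar differential inequalities on a segment (MODEL front block
of Tao's lattice, Tao 2016 §4); helper lemmas for the crux, no stub credit; nothing here is a statement about
the Navier–Stokes equations; no summit, rung or crux is proved. NS regularity is not proved by this line.
-/

noncomputable section

-- the sub-problem namespace `Summit.NavierStokesRegularity.NavierStokesRegularity` repeats the summit name by design (D-0017)
set_option linter.dupNamespace false

open Real Set

namespace Summit.NavierStokesRegularity.NavierStokesRegularity.Theorems

/-- Segment monotonicity: if `F` has one-sided derivative `F′` within `[0, T]` at every point of `[0, T]` and
`F′ ≤ 0` on the open interval, then `F(s) ≤ F(0)` on `[0, T]`. [folklore] -/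
theorem htcIB_le_of_derivWithin_nonpos {F F' : ℝ → ℝ} {T : ℝ}
    (hF : ∀ s ∈ Icc 0 T, HasDerivWithinAt F (F' s) (Icc 0 T) s) (hnp : ∀ s ∈ Ioo 0 T, F' s ≤ 0) :
    ∀ s ∈ Icc 0 T, F s ≤ F 0 := by
  intro s hs
  have hanti : AntitoneOn F (Icc 0 T) := by
    refine antitoneOn_of_deriv_nonpos (convex_Icc 0 T) (fun r hr => (hF r hr).continuousWithinAt)
      (fun r hr => ?_) (fun r hr => ?_)
    · rw [interior_Icc] at hr
      exact ((hF r (Ioo_subset_Icc_self hr)).hasDerivAt (Icc_mem_nhds hr.1 hr.2)).differentiableAt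
        |>.differentiableWithinAt
    · rw [interior_Icc] at hr
      rw [((hF r (Ioo_subset_Icc_self hr)).hasDerivAt (Icc_mem_nhds hr.1 hr.2)).deriv]
      exact hnp r hr
  exact hanti (left_mem_Icc.2 (hs.1.trans hs.2)) hs hs.1

/-- **Pointwise receiver bound during the delay, segment form.** On `[0, T]` let `y′ = gu² − w + f` with
`g ≥ 0`, `w ≥ 0`, `|f| ≤ φ`, and `u′ = ρu + f₂` with `ρ ≥ ρ₀ > 0`, `|f₂| ≤ φ₂`, `0 ≤ u ≤ h`. Then
`y(t) ≤ y(0) + (g/2ρ₀)(u(t)² − u(0)²) + (φ + gφ₂h/ρ₀)·t` for `t ∈ [0, T]`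
(`K = y − (g/2ρ₀)u² − (φ + gφ₂h/ρ₀)t` is non-increasing). [folklore] -/
theorem htcIB_receiver_pointwise {y u w f ρ f₂ : ℝ → ℝ} {T g ρ₀ φ φ₂ h : ℝ} (hg : 0 ≤ g) (hρ₀ : 0 < ρ₀)
    (hy : ∀ s ∈ Icc 0 T, HasDerivWithinAt y (g * u s ^ 2 - w s + f s) (Icc 0 T) s)
    (hu : ∀ s ∈ Icc 0 T, HasDerivWithinAt u (ρ s * u s + f₂ s) (Icc 0 T) s)
    (hρ : ∀ s ∈ Icc 0 T, ρ₀ ≤ ρ s) (hw : ∀ s ∈ Icc 0 T, 0 ≤ w s) (hf : ∀ s ∈ Icc 0 T, |f s| ≤ φ)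
    (hf₂ : ∀ s ∈ Icc 0 T, |f₂ s| ≤ φ₂) (huh : ∀ s ∈ Icc 0 T, 0 ≤ u s ∧ u s ≤ h) :
    ∀ t ∈ Icc 0 T, y t ≤ y 0 + g / (2 * ρ₀) * (u t ^ 2 - u 0 ^ 2) + (φ + g * φ₂ * h / ρ₀) * t := by
  have hu2 : ∀ s ∈ Icc 0 T, HasDerivWithinAt (fun q => u q ^ 2) (2 * u s * (ρ s * u s + f₂ s)) (Icc 0 T) s := by
    intro s hs
    have h1 := (hu s hs).mul (hu s hs)
    have h2 : (fun q => u q ^ 2) = fun q => u q * u q := funext fun q => sq (u q)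
    rw [h2]
    exact h1.congr_deriv (by ring)
  have hK : ∀ s ∈ Icc 0 T, HasDerivWithinAt
      (fun q => y q - g / (2 * ρ₀) * u q ^ 2 - (φ + g * φ₂ * h / ρ₀) * q)
      ((g * u s ^ 2 - w s + f s) - g / (2 * ρ₀) * (2 * u s * (ρ s * u s + f₂ s)) -
        (φ + g * φ₂ * h / ρ₀) * 1) (Icc 0 T) s :=
    fun s hs => ((hy s hs).sub ((hu2 s hs).const_mul _)).sub ((hasDerivWithinAt_id s _).const_mul _)
  have hK' : ∀ s ∈ Ioo 0 T, (g * u s ^ 2 - w s + f s) - g / (2 * ρ₀) * (2 * u s * (ρ s * u s + f₂ s)) -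
      (φ + g * φ₂ * h / ρ₀) * 1 ≤ 0 := by
    intro s hs
    have hs' : s ∈ Icc 0 T := Ioo_subset_Icc_self hs
    obtain ⟨hus0, hush⟩ := huh s hs'
    have hws := hw s hs'
    have hfs := (abs_le.1 (hf s hs')).2
    have hf₂s := (abs_le.1 (hf₂ s hs')).1
    have hρs := hρ s hs'
    -- g u² (1 − ρ/ρ₀) ≤ 0
    have h1 : g * u s ^ 2 - g / (2 * ρ₀) * (2 * u s * (ρ s * u s)) ≤ 0 := by
      have h2 : g * u s ^ 2 - g / (2 * ρ₀) * (2 * u s * (ρ s * u s)) = -(g / ρ₀ * u s ^ 2 * (ρ s - ρ₀)) := by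
        field_simp
        ring
      rw [h2, neg_nonpos]
      have : 0 ≤ ρ s - ρ₀ := by linarith
      positivity
    -- −(g/2ρ₀)·2u f₂ ≤ gφ₂h/ρ₀
    have h3 : -(g / (2 * ρ₀) * (2 * u s * f₂ s)) ≤ g * φ₂ * h / ρ₀ := by
      have h4 : -(u s * f₂ s) ≤ h * φ₂ := by
        have h5 : u s * (-f₂ s) ≤ u s * φ₂ := mul_le_mul_of_nonneg_left (by linarith) hus0
        have h6 : u s * φ₂ ≤ h * φ₂ := by
          have hφ₂ : 0 ≤ φ₂ := le_trans (abs_nonneg _) (hf₂ s hs')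
          exact mul_le_mul_of_nonneg_right hush hφ₂
        linarith
      have h7 : -(g / (2 * ρ₀) * (2 * u s * f₂ s)) = g / ρ₀ * (-(u s * f₂ s)) := by
        field_simp
      rw [h7]
      have h8 : g / ρ₀ * (-(u s * f₂ s)) ≤ g / ρ₀ * (h * φ₂) := mul_le_mul_of_nonneg_left h4 (by positivity)
      have h9 : g / ρ₀ * (h * φ₂) = g * φ₂ * h / ρ₀ := by ring
      linarith
    have h10 : g / (2 * ρ₀) * (2 * u s * (ρ s * u s + f₂ s)) =
        g / (2 * ρ₀) * (2 * u s * (ρ s * u s)) + g / (2 * ρ₀) * (2 * u s * f₂ s) := by ring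
    rw [h10]
    linarith
  have hKle := htcIB_le_of_derivWithin_nonpos hK hK'
  intro t ht
  have h1 := hKle t ht
  simp only [mul_zero, sub_zero] at h1
  have h2 : g / (2 * ρ₀) * (u t ^ 2 - u 0 ^ 2) = g / (2 * ρ₀) * u t ^ 2 - g / (2 * ρ₀) * u 0 ^ 2 := by ring
  linarith

/-- **The premature-ignition budget of a delay window, segment form.** In the setting of
`htcIB_receiver_pointwise`, let `R ≤ e′y + φ_R` (`e′ ≥ 0`) on `[0, T]` and let `Λ` be a primitive of `R`
within the window with `Λ(0) = 0`. Then for `t ∈ [0, T]`: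
`Λ(t) ≤ e′y(0)t + e′(φ + gφ₂h/ρ₀)t²/2 + (e′g/4ρ₀²)(h² + 2φ₂ht) + φ_R t` — only the initial receiver
residue `y(0)` is multiplied by the window length. [folklore] -/
theorem htcIB_ignition_budget {y u w f ρ f₂ R Λ : ℝ → ℝ} {T g ρ₀ φ φ₂ h e' φR : ℝ} (hg : 0 ≤ g)
    (hρ₀ : 0 < ρ₀) (he' : 0 ≤ e')
    (hy : ∀ s ∈ Icc 0 T, HasDerivWithinAt y (g * u s ^ 2 - w s + f s) (Icc 0 T) s)
    (hu : ∀ s ∈ Icc 0 T, HasDerivWithinAt u (ρ s * u s + f₂ s) (Icc 0 T) s)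
    (hρ : ∀ s ∈ Icc 0 T, ρ₀ ≤ ρ s) (hw : ∀ s ∈ Icc 0 T, 0 ≤ w s) (hf : ∀ s ∈ Icc 0 T, |f s| ≤ φ)
    (hf₂ : ∀ s ∈ Icc 0 T, |f₂ s| ≤ φ₂) (huh : ∀ s ∈ Icc 0 T, 0 ≤ u s ∧ u s ≤ h)
    (hΛ : ∀ s ∈ Icc 0 T, HasDerivWithinAt Λ (R s) (Icc 0 T) s) (hΛ0 : Λ 0 = 0)
    (hR : ∀ s ∈ Icc 0 T, R s ≤ e' * y s + φR) :
    ∀ t ∈ Icc 0 T, Λ t ≤ e' * y 0 * t + e' * (φ + g * φ₂ * h / ρ₀) * t ^ 2 / 2 +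
      e' * g / (4 * ρ₀ ^ 2) * (h ^ 2 + 2 * φ₂ * h * t) + φR * t := by
  have hpt := htcIB_receiver_pointwise hg hρ₀ hy hu hρ hw hf hf₂ huh
  have hu2 : ∀ s ∈ Icc 0 T, HasDerivWithinAt (fun q => u q ^ 2) (2 * u s * (ρ s * u s + f₂ s)) (Icc 0 T) s := by
    intro s hs
    have h1 := (hu s hs).mul (hu s hs)
    have h2 : (fun q => u q ^ 2) = fun q => u q * u q := funext fun q => sq (u q)
    rw [h2]
    exact h1.congr_deriv (by ring)
  have hsq : ∀ s ∈ Icc 0 T, HasDerivWithinAt (fun q : ℝ => q * q) (1 * s + s * 1) (Icc 0 T) s :=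
    fun s hs => (hasDerivWithinAt_id s _).mul (hasDerivWithinAt_id s _)
  set c₁ : ℝ := φ + g * φ₂ * h / ρ₀ with hc₁
  set c₂ : ℝ := e' * g / (4 * ρ₀ ^ 2) with hc₂
  have hc₂nn : 0 ≤ c₂ := by positivity
  have hN : ∀ s ∈ Icc 0 T, HasDerivWithinAt
      (fun q => Λ q - e' * y 0 * q - e' * c₁ * (q * q) / 2 - c₂ * (u q ^ 2 + 2 * φ₂ * h * q) - φR * q)
      (R s - e' * y 0 * 1 - e' * c₁ * (1 * s + s * 1) / 2 -
        c₂ * (2 * u s * (ρ s * u s + f₂ s) + 2 * φ₂ * h * 1) - φR * 1) (Icc 0 T) s := by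
    intro s hs
    exact ((((hΛ s hs).sub ((hasDerivWithinAt_id s _).const_mul _)).sub
      (((hsq s hs).const_mul (e' * c₁)).div_const 2)).sub
      (((hu2 s hs).add ((hasDerivWithinAt_id s _).const_mul _)).const_mul c₂)).sub
      ((hasDerivWithinAt_id s _).const_mul φR)
  have hN' : ∀ s ∈ Ioo 0 T, R s - e' * y 0 * 1 - e' * c₁ * (1 * s + s * 1) / 2 -
      c₂ * (2 * u s * (ρ s * u s + f₂ s) + 2 * φ₂ * h * 1) - φR * 1 ≤ 0 := by
    intro s hs
    have hs' : s ∈ Icc 0 T := Ioo_subset_Icc_self hs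
    obtain ⟨hus0, hush⟩ := huh s hs'
    have hf₂s := (abs_le.1 (hf₂ s hs')).1
    have hρs := hρ s hs'
    have hys := hpt s hs'
    have hRs := hR s hs'
    -- c₂ (2u(ρu + f₂) + 2φ₂h) ≥ c₂ · 2ρ₀ u² = (e′g/2ρ₀) u²
    have h1 : c₂ * (2 * ρ₀ * u s ^ 2) ≤ c₂ * (2 * u s * (ρ s * u s + f₂ s) + 2 * φ₂ * h * 1) := by
      apply mul_le_mul_of_nonneg_left _ hc₂nn
      have h2 : u s * (-f₂ s) ≤ h * φ₂ := by
        have h3 : u s * (-f₂ s) ≤ u s * φ₂ := mul_le_mul_of_nonneg_left (by linarith) hus0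
        have hφ₂ : 0 ≤ φ₂ := le_trans (abs_nonneg _) (hf₂ s hs')
        have h4 : u s * φ₂ ≤ h * φ₂ := mul_le_mul_of_nonneg_right hush hφ₂
        linarith
      have h5 : 2 * ρ₀ * u s ^ 2 ≤ 2 * u s * (ρ s * u s) := by
        have : 0 ≤ u s ^ 2 * (ρ s - ρ₀) := mul_nonneg (sq_nonneg _) (by linarith)
        nlinarith
      nlinarith
    have h6 : c₂ * (2 * ρ₀ * u s ^ 2) = e' * (g / (2 * ρ₀) * u s ^ 2) := by
      rw [hc₂]; field_simp; ring
    -- e′ y ≤ e′ (y0 + (g/2ρ₀)(u² − u0²) + c₁ s)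
    have h7 : e' * y s ≤ e' * (y 0 + g / (2 * ρ₀) * (u s ^ 2 - u 0 ^ 2) + c₁ * s) :=
      mul_le_mul_of_nonneg_left hys he'
    have h8 : 0 ≤ e' * (g / (2 * ρ₀) * u 0 ^ 2) := by positivity
    have h9 : e' * c₁ * (1 * s + s * 1) / 2 = e' * (c₁ * s) := by ring
    nlinarith
  have hNle := htcIB_le_of_derivWithin_nonpos hN hN'
  intro t ht
  have h1 := hNle t ht
  simp only [mul_zero, sub_zero, add_zero, hΛ0] at h1
  obtain ⟨hut0, huth⟩ := huh t ht
  obtain ⟨hu00, hu0h⟩ := huh 0 (left_mem_Icc.2 (ht.1.trans ht.2))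
  have h2 : u t ^ 2 ≤ h ^ 2 := pow_le_pow_left₀ hut0 huth 2
  have h3 : c₂ * (u t ^ 2 + 2 * φ₂ * h * t) ≤ c₂ * (h ^ 2 + 2 * φ₂ * h * t) :=
    mul_le_mul_of_nonneg_left (by linarith) hc₂nn
  have h4 : 0 ≤ c₂ * (u 0 ^ 2 + 2 * φ₂ * h * 0) := by
    have : 0 ≤ u 0 ^ 2 := sq_nonneg _
    simp only [mul_zero, add_zero]
    positivity
  have h5 : e' * c₁ * (t * t) / 2 = e' * c₁ * t ^ 2 / 2 := by rw [sq]
  rw [hc₂] at h3 h4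
  linarith

end Summit.NavierStokesRegularity.NavierStokesRegularity.Theorems

end
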